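import Summits.RiemannHypothesis.RiemannHypothesis.Theorems.LiTailLaguerreFejerBridge
import Summits.RiemannHypothesis.RiemannHypothesis.Theorems.LiTailLaguerreBridgeCoffey
import Summits.RiemannHypothesis.RiemannHypothesis.Theorems.LiTailLaguerreStaircaseHold
import HarnessLib

/-!
# RiemannHypothesis / LiTailLaguerre — the WEAK FEJÉR LAW of the Coffey–Laguerre terms, and PART D's WINDOW ECHO LAW
# T3e `LiZeroWindowEchoes` is a theorem (RH-FREE PROOF-OF-DATA)

RH-FREE [rh-li-eng g6].  Cell `pub/rh-li`, rounds 6–7 (PART D `Theorems/LiPrimeEchoDefs.lean`, PART K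
`Theorems/LiTailLaguerreDefs.lean`).  Two results:

* `liCoffeyTerm_add_liPrimeEcho_bounded` — **the weak Fejér law:** for every `m ≥ 2` there is `C_m` with
  `|liCoffeyTerm m n + liPrimeEcho m n| ≤ C_m` for all `n ≥ 1`, i.e. the Bombieri–Lagarias/Coffey term
  `(Λ(m)/m) L¹_{n−1}(log m)` of the arithmetic formula for `λ_n` IS minus the prime echo
  `E_m(n) = π^{−1/2} Λ(m) m^{−1/2} (log m)^{−3/4} n^{1/4} cos(2√(n log m) + π/4)` up to a bounded error (Fejér 1909 /
  Szegő Thm 8.22.1 for `α = 1` give `O(n^{−1/4})`, the typed `LiCoffeyTermFejer`; the bounded form is proved here from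
  the LAGUERRE BRIDGE `(Λ(m)/(π√m)) ∫_0^∞ 2(1 − cos nθ) cos(t log m) dt = liCoffeyTerm m n`
  (`PrimeTail.stub_bridge_coffey`, tail-p2) and the first-order stationary-phase evaluation of the bridge integral
  `Fejer.bridge_asymptotic` (`Theorems/LiTailLaguerreFejerBridge.lean`); the finitely many `n` below the threshold
  `max(2 log m, 4/log m, 1)` are absorbed into the constant).  DATA: rh-li-eng-6 g4's certified Laguerre table (kit j258512,
  1 547 values, `m ∈ {2,3,4,5,7,8,9}`, `n ≤ 10⁷`): `sup n^{1/4}|liCoffeyTerm + liPrimeEcho| = 0.0645`.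
* `liZeroWindowEchoes_holds : LiZeroWindowEchoes` — **PART D's WINDOW ECHO LAW T3e is a THEOREM:** for all admissible cuts
  `0 < c₁ < c₂` (no prime power with `log m ∈ {1/c₁², 1/c₂²}`) there is `C` with, for all `n ≥ 2`,
  `|liZeroTraceWindow n (c₁√n) (c₂√n) − liSmoothTraceWindow n (c₁√n) (c₂√n) + Σ_{e^{1/c₂²} ≤' m ≤ e^{1/c₁²}} E_m(n)| ≤ C log² n`
  — THE ZEROS OF HEIGHT `(c₁√n, c₂√n]`, Li-weighted whatever their real parts, ECHO EXACTLY THE PRIME POWERS `m` WITH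
  `c₂^{−2} ≤ log m < c₁^{−2}`, each with its Fejér chirp `−E_m(n)`.  Composition: eng-4 g5's `liZeroWindowEchoes_of_fejer`
  (`Theorems/LiTailLaguerreStaircaseHold.lean`: the PROVED round-7 leaf `liZeroTailLaguerre_proof` differenced at the two
  cuts = the Laguerre staircase) + the weak Fejér law.  DATA it explains: ECHO-X (DATA.md §N, kit j252784: 13 windows,
  `n ≤ 4.8·10¹²`, `sup|D − P₅₀| ≤ 3.3`), the echo staircase of lineage F / Z-echo (§F/§M), Q-LI-4.

Labels: RH-FREE for all `n`; PROOF-OF-DATA; NOT height-buying.  WHAT THIS IS NOT: not evidence for RH and not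
RH-sensitive (every zero of the window is summed whatever its real part); the weak Fejér law is a classical fact about
Laguerre polynomials.  Nothing here bears on the truth of RH.
-/

noncomputable section

-- D-0017: `Summit.<S>.<S>.…` is the designed namespace of a single-problem summit.
set_option linter.dupNamespace false

open Set MeasureTheory
open scoped ArithmeticFunction.vonMangoldt

namespace Summit.RiemannHypothesis.RiemannHypothesis.Theorems.LiTheory

namespace Fejer

/-- `y^{−3/4} x^{1/4} = √x/(y (x/y)^{1/4})` for `x, y > 0` (both sides are positive with fourth power `x/y³`). -/
theorem rpow_quarter_form {y x : ℝ} (hy : 0 < y) (hx : 0 < x) :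
    y ^ (-(3 / 4 : ℝ)) * x ^ (1 / 4 : ℝ) = Real.sqrt x / (y * Real.sqrt (Real.sqrt (x / y))) := by
  have hL : 0 < y ^ (-(3 / 4 : ℝ)) * x ^ (1 / 4 : ℝ) := by positivity
  have hR : 0 < Real.sqrt x / (y * Real.sqrt (Real.sqrt (x / y))) := by positivity
  rw [← pow_left_inj₀ hL.le hR.le (by norm_num : (4 : ℕ) ≠ 0)]
  have e1 : (y ^ (-(3 / 4 : ℝ))) ^ (4 : ℕ) = (y ^ (3 : ℕ))⁻¹ := by
    rw [← Real.rpow_natCast, ← Real.rpow_mul hy.le, show (-(3 / 4 : ℝ)) * ((4 : ℕ) : ℝ) = -((3 : ℕ) : ℝ) by norm_num,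
      Real.rpow_neg hy.le, Real.rpow_natCast]
  have e2 : (x ^ (1 / 4 : ℝ)) ^ (4 : ℕ) = x := by
    rw [← Real.rpow_natCast, ← Real.rpow_mul hx.le, show (1 / 4 : ℝ) * ((4 : ℕ) : ℝ) = 1 by norm_num, Real.rpow_one]
  have e3 : Real.sqrt x ^ (4 : ℕ) = x ^ 2 := by
    rw [show (4 : ℕ) = 2 * 2 from rfl, pow_mul, Real.sq_sqrt hx.le]
  have e4 : Real.sqrt (Real.sqrt (x / y)) ^ (4 : ℕ) = x / y := by
    rw [show (4 : ℕ) = 2 * 2 from rfl, pow_mul, Real.sq_sqrt (Real.sqrt_nonneg _), Real.sq_sqrt (by positivity)]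
  rw [mul_pow, div_pow, mul_pow, e1, e2, e3, e4]
  field_simp

/-- The Coffey term plus the echo, as the bridge integral plus its stationary-phase main term:
`liCoffeyTerm m n + liPrimeEcho m n = (Λ(m)/(π√m)) · (∫_0^∞ 2(1 − cos nθ) cos(t log m) dt
  + √π √n/(log m · (n/log m)^{1/4}) cos(2√(n log m) + π/4))` (`m ≥ 2`, `n ≥ 1`). -/
theorem coffey_add_echo_eq {m n : ℕ} (hm : 2 ≤ m) (hn : 1 ≤ n) :
    liCoffeyTerm m n + liPrimeEcho m n
      = (Λ m : ℝ) / (Real.pi * Real.sqrt m) *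
        ((∫ t in Ioi (0 : ℝ), 2 * (1 - Real.cos (n * liZeroAngle t)) * Real.cos (t * Real.log m))
          + Real.sqrt Real.pi * Real.sqrt n / (Real.log m * Real.sqrt (Real.sqrt (n / Real.log m)))
              * Real.cos (2 * Real.sqrt (n * Real.log m) + Real.pi / 4)) := by
  have hlog : 0 < Real.log m := Real.log_pos (by exact_mod_cast (show 1 < m by omega))
  have hn0 : (0 : ℝ) < n := by exact_mod_cast (show 0 < n by omega)
  have hm0 : (0 : ℝ) < m := by exact_mod_cast (show 0 < m by omega)
  have hsπ : Real.sqrt Real.pi ≠ 0 := (Real.sqrt_pos.2 Real.pi_pos).ne'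
  have hsm : Real.sqrt m ≠ 0 := (Real.sqrt_pos.2 hm0).ne'
  have hπ : Real.sqrt Real.pi * Real.sqrt Real.pi = Real.pi := Real.mul_self_sqrt Real.pi_pos.le
  rw [mul_add, PrimeTail.stub_bridge_coffey m n hm hn]
  congr 1
  have key := rpow_quarter_form hlog hn0
  have e1 : (Λ m : ℝ) / Real.sqrt m / Real.sqrt Real.pi = (Λ m : ℝ) / (Real.pi * Real.sqrt m) * Real.sqrt Real.pi := by
    rw [eq_comm, div_mul_eq_mul_div, div_div, div_eq_div_iff (by positivity) (by positivity)]
    calc (Λ m : ℝ) * Real.sqrt Real.pi * (Real.sqrt m * Real.sqrt Real.pi)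
        = (Λ m : ℝ) * Real.sqrt m * (Real.sqrt Real.pi * Real.sqrt Real.pi) := by ring
      _ = (Λ m : ℝ) * (Real.pi * Real.sqrt m) := by rw [hπ]; ring
  unfold liPrimeEcho
  rw [e1]
  calc (Λ m : ℝ) / (Real.pi * Real.sqrt m) * Real.sqrt Real.pi * Real.log m ^ (-(3 / 4 : ℝ))
        * ((n : ℝ) ^ (1 / 4 : ℝ) * Real.cos (2 * Real.sqrt (n * Real.log m) + Real.pi / 4))
      = (Λ m : ℝ) / (Real.pi * Real.sqrt m) * (Real.sqrt Real.pi
          * (Real.log m ^ (-(3 / 4 : ℝ)) * (n : ℝ) ^ (1 / 4 : ℝ))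
          * Real.cos (2 * Real.sqrt (n * Real.log m) + Real.pi / 4)) := by ring
    _ = (Λ m : ℝ) / (Real.pi * Real.sqrt m) * (Real.sqrt Real.pi
          * (Real.sqrt n / (Real.log m * Real.sqrt (Real.sqrt (n / Real.log m))))
          * Real.cos (2 * Real.sqrt (n * Real.log m) + Real.pi / 4)) := by rw [key]
    _ = _ := by ring

end Fejer

/-- **THE WEAK FEJÉR LAW of the Coffey–Laguerre terms (RH-FREE).**  For every `m ≥ 2` there is `C` with
`|liCoffeyTerm m n + liPrimeEcho m n| ≤ C` for all `n ≥ 1`: `(Λ(m)/m) L¹_{n−1}(log m) = −E_m(n) + O_m(1)`.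
(Fejér 1909 / Szegő, *Orthogonal Polynomials*, Thm 8.22.1, `α = 1`, in the weak form with a bounded instead of an
`O(n^{−1/4})` error; proof: Laguerre bridge + first-order stationary phase, `Fejer.bridge_asymptotic`.) -/
theorem liCoffeyTerm_add_liPrimeEcho_bounded :
    ∀ m : ℕ, 2 ≤ m → ∃ C : ℝ, ∀ n : ℕ, 1 ≤ n → |liCoffeyTerm m n + liPrimeEcho m n| ≤ C := by
  intro m hm
  set y := Real.log m with hy
  have hy0 : 0 < y := Real.log_pos (by exact_mod_cast (show 1 < m by omega))
  have hm0 : (0 : ℝ) < m := by exact_mod_cast (show 0 < m by omega)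
  set K : ℝ := (Λ m : ℝ) / (Real.pi * Real.sqrt m) with hK
  have hΛ : (0 : ℝ) ≤ Λ m := ArithmeticFunction.vonMangoldt_nonneg
  have hK0 : 0 ≤ K := by positivity
  set B : ℝ := 2 + 4 * 10 ^ 9 / y + 2 * Real.sqrt y + 1 / Real.sqrt y with hB
  have hB0 : 0 ≤ B := by positivity
  set N : ℕ := ⌈2 * y⌉₊ + ⌈4 / y⌉₊ + 1 with hN
  set S : ℝ := ∑ k ∈ Finset.range N, |liCoffeyTerm m k + liPrimeEcho m k| with hS
  have hS0 : 0 ≤ S := Finset.sum_nonneg fun _ _ ↦ abs_nonneg _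
  have hKB : 0 ≤ K * B := mul_nonneg hK0 hB0
  refine ⟨K * B + S, fun n hn ↦ ?_⟩
  rcases lt_or_ge n N with hlt | hge
  · have h : |liCoffeyTerm m n + liPrimeEcho m n| ≤ S :=
      Finset.single_le_sum (f := fun k ↦ |liCoffeyTerm m k + liPrimeEcho m k|) (fun _ _ ↦ abs_nonneg _)
        (Finset.mem_range.2 hlt)
    linarith
  · have hnR : (N : ℝ) ≤ n := by exact_mod_cast hge
    rw [hN] at hnR
    push_cast at hnR
    have h2y : 2 * y ≤ n := by linarith [Nat.le_ceil (2 * y)]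
    have h4y : 4 / y ≤ n := by linarith [Nat.le_ceil (4 / y)]
    have key := Fejer.bridge_asymptotic hy0 h2y h4y hn
    rw [Fejer.coffey_add_echo_eq hm hn, abs_mul, abs_of_nonneg hK0]
    calc K * |(∫ t in Ioi (0 : ℝ), 2 * (1 - Real.cos (n * liZeroAngle t)) * Real.cos (t * y))
            + Real.sqrt Real.pi * Real.sqrt n / (y * Real.sqrt (Real.sqrt (n / y)))
              * Real.cos (2 * Real.sqrt (n * y) + Real.pi / 4)|
        ≤ K * B := mul_le_mul_of_nonneg_left key hK0
      _ ≤ K * B + S := by linarith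

/-- **PART D's WINDOW ECHO LAW T3e `LiZeroWindowEchoes` holds (RH-FREE PROOF-OF-DATA):** the zeros of height
`(c₁√n, c₂√n]` echo exactly the prime powers `m` with `c₂^{−2} ≤ log m < c₁^{−2}`, each with its Fejér chirp `−E_m(n)`,
up to `O(log² n)` — the PROVED round-7 leaf differenced at two cuts (`liZeroWindowEchoes_of_fejer`, eng-4 g5) + the weak
Fejér law. -/
theorem liZeroWindowEchoes_holds : LiZeroWindowEchoes :=
  liZeroWindowEchoes_of_fejer liCoffeyTerm_add_liPrimeEcho_bounded

end Summit.RiemannHypothesis.RiemannHypothesis.Theorems.LiTheory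

end
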